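import Summits.QuantumFields.YangMills.Theorems.ColdStartUniversalityLatticeLangevinWilsonLoopConcentration
import Summits.QuantumFields.YangMills.Theorems.ColdStartUniversalityLatticeLangevinPlaquetteConcentration
import Summits.QuantumFields.YangMills.Theorems.ColdStartUniversalityLatticeLangevinCrossCorrelationUniform
import Summits.QuantumFields.YangMills.Theorems.ColdStartUniversalityUniformColdStartMixingFixedCutoffMixingTimeWindow
import HarnessLib

/-!
# Route `ColdStartUniversality`, aside K_A1 `UniformColdStartMixing` (24809) — EQUILIBRIUM FLUCTUATIONS AT A FIXED CUT-OFF IN THE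
# STRONG-COUPLING WINDOW `γ ε_K > 6`, in the route's cut-off vocabulary: Gaussian concentration and `O(1/L_K³)` variance of the action density
# and of spatially averaged `R×T` Wilson loops under `μ_K`, and `e^(−(1 − 6/(γε_K))t)` decay of all stationary time-correlations

Helper file (seat `ym-line-csu-p1`, g27; `--supports stmt-QuantumFields-24809`).  Planner-facing reading of the volume-uniform package
(`…PlaquetteConcentration`, `…PlaquetteVariance`, `…WilsonLoopConcentration`, `…CrossCorrelationUniform`) at the cut-off coupling
`β'_K = (γε_K)⁻¹/2` on the lattice `(ℤ/L_K)³`, `L_K = (F.P K).sitesPerDir 0` (so `#𝒫 = 3L_K³`, `#sites = L_K³`, `1 − 12|β'_K| = 1 − 6/(γε_K)`,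
cf. `window_coupling_bounds`):
* ★★ `actionDensity_concentration_fixedCutoff_window` — `μ_K{r ≤ |S_W/(3L_K³) − ⟨·⟩|} ≤ 2exp(−(1 − 6/(γε_K))·3L_K³·r²/64)`;
* ★★ `actionDensity_variance_fixedCutoff_window` — `Var_(μ_K)(S_W/(3L_K³)) ≤ 32/((1 − 6/(γε_K))·3L_K³)`;
* ★★ `wilsonLoop_variance_fixedCutoff_window` / ★★★ `wilsonLoop_concentration_fixedCutoff_window` — for the S12 rectangular Wilson loop
  `W_(R×T)` averaged over translations: `Var ≤ 48(R+T)²/((1 − 6/(γε_K))L_K³)`, `μ_K{r ≤ |W̄ − ⟨W̄⟩|} ≤ 2exp(−(1 − 6/(γε_K))L_K³r²/(96(R+T)²))`;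
* ★★ `crossCorrelation_fixedCutoff_window` — `|⟨G, P_tF⟩_(μ_K)| ≤ e^(−(1 − 6/(γε_K))t)‖F‖‖G‖` for centred continuous `F, G` and every
  realising kernel family of the SZZ dynamics at `β'_K`.
So INSIDE the window the fixed-cut-off equilibrium `μ_K` is a Gaussian-concentrated, exponentially time-decorrelated state uniformly in the lattice
size `L_K`.  [cite: ShenZhuZhu2022, §4 Theorem 4.2, Corollaries 4.7–4.8]
PLANNER-FACING, HONEST: the window `γ ε_K > 6` contains only the COARSE cut-offs (`ε_K → 0` leaves it); nothing K-uniform is proved; 24809 is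
ASIDE and NOT restated; no crux, rung of the ladder or summit statement is proved; the Yang–Mills mass gap is NOT proved.
-/

set_option autoImplicit false

noncomputable section

namespace Summit.QuantumFields.YangMills.Theorems.ColdStartUniversality

open MeasureTheory ProbabilityTheory Finset
open scoped NNReal ENNReal BigOperators
open Literature.Probability.Process Literature.MathematicalPhysics.QuantumFieldTheory
open Literature.MathematicalPhysics.QuantumLattice (fundamentalRep fundamentalLatticeRep continuous_fundamentalRep)
open Literature.MathematicalPhysics.QuantumFieldTheory.Balaban1983to89

/-- The lattice of the cut-off `K` has `L_K³` sites and `3L_K³` plaquettes (real-cast forms). [folklore] -/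
theorem card_site_plaquette_fixedCutoff (F : T3ContinuumYM3Torus.T3Family) (K : ℕ) :
    (Fintype.card (Site 3 ((F.P K).sitesPerDir 0)) : ℝ) = ((((F.P K).sitesPerDir 0) : ℕ) : ℝ) ^ 3 ∧ (Fintype.card (Plaquette 3 ((F.P K).sitesPerDir 0)) : ℝ) = 3 * ((((F.P K).sitesPerDir 0) : ℕ) : ℝ) ^ 3 := by
  refine ⟨?_, ?_⟩
  · rw [card_site_three]; push_cast; ring
  · rw [card_plaquette_three]; push_cast; ring

/-- ★★ **Gaussian concentration of the action density under `μ_K` in the window.**  For `6 < γ ε_K` and `r ≥ 0`: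
`μ_K{r ≤ |S_W/(3L_K³) − ⟨S_W/(3L_K³)⟩|} ≤ 2·exp(−(1 − 6/(γε_K))·(3L_K³)·r²/64)`. [cite: ShenZhuZhu2022, §4 Corollary 4.8] -/
theorem actionDensity_concentration_fixedCutoff_window (F : T3ContinuumYM3Torus.T3Family) (γ : ℝ) (K : ℕ) (hK : 6 < γ * (F.P K).eps)
    (r : ℝ) (hr : 0 ≤ r) :
    ((wilsonMeasure (d := 3) (L := ((F.P K).sitesPerDir 0)) (fundamentalRep (Fin 2)) ((γ * (F.P K).eps)⁻¹ / 2))).real {V | r ≤ |wilsonAction (fundamentalRep (Fin 2)) V / (3 * ((((F.P K).sitesPerDir 0) : ℕ) : ℝ) ^ 3) -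
        ∫ V', wilsonAction (fundamentalRep (Fin 2)) V' / (3 * ((((F.P K).sitesPerDir 0) : ℕ) : ℝ) ^ 3) ∂(wilsonMeasure (d := 3) (L := ((F.P K).sitesPerDir 0)) (fundamentalRep (Fin 2)) ((γ * (F.P K).eps)⁻¹ / 2))|} ≤
      2 * Real.exp (-((1 - 6 / (γ * (F.P K).eps)) * (3 * ((((F.P K).sitesPerDir 0) : ℕ) : ℝ) ^ 3) * r ^ 2 / 64)) := by
  obtain ⟨hβ, hrate⟩ := window_coupling_bounds F γ K hK
  have h := wilson_actionDensity_concentration_uniform_volume ((F.P K).sitesPerDir 0) ((γ * (F.P K).eps)⁻¹ / 2) hβ r hr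
  rw [hrate] at h
  exact h

/-- ★★ **`O(1/L_K³)` variance of the action density under `μ_K` in the window.**  For `6 < γ ε_K`:
`Var_(μ_K)(S_W/(3L_K³)) ≤ 32/((1 − 6/(γε_K))·(3L_K³))`. [cite: ShenZhuZhu2022, §4 Corollary 4.8] -/
theorem actionDensity_variance_fixedCutoff_window (F : T3ContinuumYM3Torus.T3Family) (γ : ℝ) (K : ℕ) (hK : 6 < γ * (F.P K).eps) :
    ∫ V, (wilsonAction (fundamentalRep (Fin 2)) V / (3 * ((((F.P K).sitesPerDir 0) : ℕ) : ℝ) ^ 3) - ∫ V', wilsonAction (fundamentalRep (Fin 2)) V' / (3 * ((((F.P K).sitesPerDir 0) : ℕ) : ℝ) ^ 3) ∂(wilsonMeasure (d := 3) (L := ((F.P K).sitesPerDir 0)) (fundamentalRep (Fin 2)) ((γ * (F.P K).eps)⁻¹ / 2))) ^ 2 ∂(wilsonMeasure (d := 3) (L := ((F.P K).sitesPerDir 0)) (fundamentalRep (Fin 2)) ((γ * (F.P K).eps)⁻¹ / 2))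
      ≤ 32 / ((1 - 6 / (γ * (F.P K).eps)) * (3 * ((((F.P K).sitesPerDir 0) : ℕ) : ℝ) ^ 3)) := by
  obtain ⟨hβ, hrate⟩ := window_coupling_bounds F γ K hK
  have h := wilson_actionDensity_variance_uniform ((F.P K).sitesPerDir 0) ((γ * (F.P K).eps)⁻¹ / 2) hβ
  rw [(card_site_plaquette_fixedCutoff F K).2, hrate] at h
  exact h

/-- ★★ **`O((R+T)²/L_K³)` variance of the spatially averaged `R×T` Wilson loop under `μ_K` in the window.**  For `6 < γ ε_K`, directions `i, j` and
side lengths `R, T`: `Var_(μ_K)((L_K³)⁻¹Σ_x W_(R×T)(x)) ≤ 48(R+T)²/((1 − 6/(γε_K))·L_K³)`. [cite: ShenZhuZhu2022, §4 Corollary 4.7] -/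
theorem wilsonLoop_variance_fixedCutoff_window (F : T3ContinuumYM3Torus.T3Family) (γ : ℝ) (K : ℕ) (hK : 6 < γ * (F.P K).eps)
    (i j : Fin 3) (R T : ℕ) :
    ∫ V, ((((((((F.P K).sitesPerDir 0) : ℕ) : ℝ) ^ 3))⁻¹ * ∑ x : Site 3 ((F.P K).sitesPerDir 0), wilsonLoop (fundamentalRep (Fin 2)) x i j R T V) - ∫ V', (((((((F.P K).sitesPerDir 0) : ℕ) : ℝ) ^ 3))⁻¹ * ∑ x : Site 3 ((F.P K).sitesPerDir 0), wilsonLoop (fundamentalRep (Fin 2)) x i j R T V') ∂(wilsonMeasure (d := 3) (L := ((F.P K).sitesPerDir 0)) (fundamentalRep (Fin 2)) ((γ * (F.P K).eps)⁻¹ / 2))) ^ 2 ∂(wilsonMeasure (d := 3) (L := ((F.P K).sitesPerDir 0)) (fundamentalRep (Fin 2)) ((γ * (F.P K).eps)⁻¹ / 2))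
      ≤ 48 * ((R : ℝ) + T) ^ 2 / ((1 - 6 / (γ * (F.P K).eps)) * ((((F.P K).sitesPerDir 0) : ℕ) : ℝ) ^ 3) := by
  obtain ⟨hβ, hrate⟩ := window_coupling_bounds F γ K hK
  have h := wilson_loopAverage_variance_uniform ((F.P K).sitesPerDir 0) ((γ * (F.P K).eps)⁻¹ / 2) hβ i j R T
  rw [(card_site_plaquette_fixedCutoff F K).1, hrate] at h
  exact h

/-- ★★★ **Gaussian concentration of the spatially averaged `R×T` Wilson loop under `μ_K` in the window.**  For `6 < γ ε_K`, `0 < R + T`, `r ≥ 0`: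
`μ_K{r ≤ |W̄_(R×T) − ⟨W̄_(R×T)⟩|} ≤ 2·exp(−(1 − 6/(γε_K))·L_K³·r²/(96(R+T)²))`. [cite: ShenZhuZhu2022, §4 Corollary 4.7] -/
theorem wilsonLoop_concentration_fixedCutoff_window (F : T3ContinuumYM3Torus.T3Family) (γ : ℝ) (K : ℕ) (hK : 6 < γ * (F.P K).eps)
    (i j : Fin 3) (R T : ℕ) (hRT : 0 < R + T) (r : ℝ) (hr : 0 ≤ r) :
    ((wilsonMeasure (d := 3) (L := ((F.P K).sitesPerDir 0)) (fundamentalRep (Fin 2)) ((γ * (F.P K).eps)⁻¹ / 2))).real {V | r ≤ |(((((((F.P K).sitesPerDir 0) : ℕ) : ℝ) ^ 3))⁻¹ * ∑ x : Site 3 ((F.P K).sitesPerDir 0), wilsonLoop (fundamentalRep (Fin 2)) x i j R T V) - ∫ V', (((((((F.P K).sitesPerDir 0) : ℕ) : ℝ) ^ 3))⁻¹ * ∑ x : Site 3 ((F.P K).sitesPerDir 0), wilsonLoop (fundamentalRep (Fin 2)) x i j R T V') ∂(wilsonMeasure (d := 3) (L := ((F.P K).sitesPerDir 0)) (fundamentalRep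 (Fin 2)) ((γ * (F.P K).eps)⁻¹ / 2))|} ≤
      2 * Real.exp (-((1 - 6 / (γ * (F.P K).eps)) * ((((F.P K).sitesPerDir 0) : ℕ) : ℝ) ^ 3 * r ^ 2 / (96 * ((R : ℝ) + T) ^ 2))) := by
  obtain ⟨hβ, hrate⟩ := window_coupling_bounds F γ K hK
  have h := wilson_loopAverage_concentration_uniform ((F.P K).sitesPerDir 0) ((γ * (F.P K).eps)⁻¹ / 2) hβ i j R T hRT r hr
  rw [(card_site_plaquette_fixedCutoff F K).1, hrate] at h
  exact h

/-- ★★ **Exponential decay of stationary time-correlations of the SZZ dynamics at `β'_K` in the window.**  For `6 < γ ε_K`, every realising kernel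
family `κ` of the dynamics at `β'_K`, centred continuous `F₁`, continuous `G` and every lattice time `t`:
`|∫ G·κ_tF₁ dμ_K| ≤ e^(−(1 − 6/(γε_K))·t)·‖F₁‖_(L²(μ_K))·‖G‖_(L²(μ_K))`. [cite: RobertsRosenthal1997, Theorem 2.1] -/
theorem crossCorrelation_fixedCutoff_window (F : T3ContinuumYM3Torus.T3Family) (γ : ℝ) (K : ℕ) (hK : 6 < γ * (F.P K).eps)
    (κ : ℝ≥0 → Kernel (GaugeConfig 3 ((F.P K).sitesPerDir 0) (Matrix.specialUnitaryGroup (Fin 2) ℂ)) (GaugeConfig 3 ((F.P K).sitesPerDir 0) (Matrix.specialUnitaryGroup (Fin 2) ℂ))) [∀ t, IsMarkovKernel (κ t)]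
    (hreal : ∀ (t : ℝ≥0) (x : (GaugeConfig 3 ((F.P K).sitesPerDir 0) (Matrix.specialUnitaryGroup (Fin 2) ℂ)))
        (Ω : Type) [MeasurableSpace Ω] (P : Measure Ω) [IsProbabilityMeasure P]
        (W : ℝ≥0 → Ω → (Edge 3 ((F.P K).sitesPerDir 0) × NoiseIdx 2 → ℝ)) (hW : IsFlatBrownian W P)
        (U : ℝ≥0 → Ω → (GaugeConfig 3 ((F.P K).sitesPerDir 0) (Matrix.specialUnitaryGroup (Fin 2) ℂ))),
        (∀ ω, U 0 ω = x) →
        (latticeLangevinDynamics (fundamentalLatticeRep 2) ((γ * (F.P K).eps)⁻¹ / 2)).IsSolution (fundamentalRep (Fin 2))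
          hW.natFiltration P W U →
        κ t x = P.map (U t))
    (F₁ G' : (GaugeConfig 3 ((F.P K).sitesPerDir 0) (Matrix.specialUnitaryGroup (Fin 2) ℂ)) → ℝ) (hF : Continuous F₁) (hG : Continuous G')
    (hF0 : ∫ x, F₁ x ∂(wilsonMeasure (d := 3) (L := ((F.P K).sitesPerDir 0)) (fundamentalRep (Fin 2)) ((γ * (F.P K).eps)⁻¹ / 2)) = 0) (t : ℝ≥0) :
    |∫ x, G' x * (∫ y, F₁ y ∂(κ t x)) ∂(wilsonMeasure (d := 3) (L := ((F.P K).sitesPerDir 0)) (fundamentalRep (Fin 2)) ((γ * (F.P K).eps)⁻¹ / 2))| ≤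
      Real.exp (-(1 - 6 / (γ * (F.P K).eps)) * t) * Real.sqrt (∫ x, F₁ x * F₁ x ∂(wilsonMeasure (d := 3) (L := ((F.P K).sitesPerDir 0)) (fundamentalRep (Fin 2)) ((γ * (F.P K).eps)⁻¹ / 2))) * Real.sqrt (∫ x, G' x * G' x ∂(wilsonMeasure (d := 3) (L := ((F.P K).sitesPerDir 0)) (fundamentalRep (Fin 2)) ((γ * (F.P K).eps)⁻¹ / 2))) := by
  obtain ⟨hβ, hrate⟩ := window_coupling_bounds F γ K hK
  have h := wilson_crossCorrelation_le_uniform ((F.P K).sitesPerDir 0) ((γ * (F.P K).eps)⁻¹ / 2) hβ κ hreal F₁ G' hF hG hF0 t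
  rw [hrate] at h
  exact h

end Summit.QuantumFields.YangMills.Theorems.ColdStartUniversality
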